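import Mathlib
import HarnessLib
import Summits.ValiantsHypothesis.ValiantsHypothesis.Theorems.MonotoneRestorationOrbitRestorationQPSmlDeltaCalculus
import Summits.ValiantsHypothesis.ValiantsHypothesis.Theorems.MonotoneRestorationOrbitRestorationQPSmlDeltaNarrow
import Summits.ValiantsHypothesis.ValiantsHypothesis.Theorems.MonotoneRestorationOrbitRestorationQPSmlJohnsonRank

/-!
# Low flattening rank forces narrowness
(crux `OrbitRestorationQP`, stmt-ValiantsHypothesis-18293 — lane SML: the column-set-multilinear `ΣΠΣ` stratum of A_∞)

The `p`-world endpoint of the set-multilinear stratum (blueprint `SML-STRATUM-BLUEPRINT.md` on the crux item):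

**THEOREM `narrow_of_derivs_in_small_span`.**  Let `p ∈ ℂ[y_1, …, y_N]` be symmetric and homogeneous of degree
`d ≤ N`, let `2j ≤ N`, and suppose all `j`-th order iterated partial derivatives `∂_{ρ(0)} ⋯ ∂_{ρ(j-1)} p`
(`ρ : Fin j → Fin N`) lie in the span of fewer than `C(N-j, j)` polynomials.  Then `p` is a `ℂ`-combination of
power-sum products `Π_{k∈μ} p_k` over multisets `μ` of positive integers with `μ.sum = d` and FEWER THAN `j`
parts `≥ 2`.

Ingredients: the Johnson rank lemma (`…SmlJohnsonRank`) applied to `u ρ = ∂_ρ p` with the coefficient pairing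
`⟪g, h⟫ = Σ_m conj(g_m) h_m` (definite, invariant under renaming by permutations — constructed inside the proof,
def-free: `exists_coeffPairing`), transport of the difference-derivative fold under permutations, the
expansion `Π_i (∂_{a i} - ∂_{b i}) = Σ_ε (-1)^{#ε} ∂_{mix ε}` (`…SmlDeltaCalculus`), and the narrowness theorem
(`…SmlDeltaNarrow`).  For a symmetric `S_n`-invariant tensor in `(ℂ^N)^{⊗ d}` this says: flattening rank
`< C(N-j,j)` on `j` slots ⇒ `(j-1)`-narrow power-sum support. [folklore]
-/

set_option linter.dupNamespace false

namespace Summit.ValiantsHypothesis.ValiantsHypothesis.Theorems.SmlLowRankNarrow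

open MvPolynomial Finset SmlDeltaCalculus SmlDeltaNarrow SmlJohnsonRank

/-- **The coefficient pairing.**  On `MvPolynomial σ ℂ` there is a definite sesquilinear form invariant under
renaming by permutations of the variables: `⟪g, h⟫ = Σ_{m ∈ supp g} conj(g_m) · h_m`. [folklore] -/
theorem exists_coeffPairing (σ : Type*) [DecidableEq σ] :
    ∃ B : MvPolynomial σ ℂ →ₗ⋆[ℂ] MvPolynomial σ ℂ →ₗ[ℂ] ℂ,
      (∀ v, B v v = 0 → v = 0) ∧
      ∀ (e : Equiv.Perm σ) (g h : MvPolynomial σ ℂ), B (rename e g) (rename e h) = B g h := by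
  classical
  -- the pairing as a function
  let F : MvPolynomial σ ℂ → MvPolynomial σ ℂ → ℂ := fun g h =>
    ∑ m ∈ g.support, (starRingEnd ℂ) (coeff m g) * coeff m h
  have hF : ∀ g h, F g h = ∑ m ∈ g.support, (starRingEnd ℂ) (coeff m g) * coeff m h := fun g h => rfl
  -- the sum may be taken over any finite set containing the support
  have hFsub : ∀ (g h : MvPolynomial σ ℂ) (S : Finset (σ →₀ ℕ)), g.support ⊆ S →
      F g h = ∑ m ∈ S, (starRingEnd ℂ) (coeff m g) * coeff m h := by
    intro g h S hS
    rw [hF]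
    refine Finset.sum_subset hS fun m _ hm => ?_
    rw [notMem_support_iff.1 hm, map_zero, zero_mul]
  have hadd₁ : ∀ g₁ g₂ h, F (g₁ + g₂) h = F g₁ h + F g₂ h := by
    intro g₁ g₂ h
    rw [hFsub (g₁ + g₂) h (g₁.support ∪ g₂.support) support_add,
      hFsub g₁ h (g₁.support ∪ g₂.support) Finset.subset_union_left,
      hFsub g₂ h (g₁.support ∪ g₂.support) Finset.subset_union_right, ← Finset.sum_add_distrib]
    exact Finset.sum_congr rfl fun m _ => by rw [coeff_add, map_add, add_mul]
  have hsmul₁ : ∀ (c : ℂ) g h, F (c • g) h = (starRingEnd ℂ) c • F g h := by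
    intro c g h
    rw [hFsub (c • g) h g.support support_smul, hF, smul_eq_mul, Finset.mul_sum]
    exact Finset.sum_congr rfl fun m _ => by rw [coeff_smul, smul_eq_mul, map_mul, mul_assoc]
  have hadd₂ : ∀ g h₁ h₂, F g (h₁ + h₂) = F g h₁ + F g h₂ := by
    intro g h₁ h₂
    simp only [hF, coeff_add, mul_add, Finset.sum_add_distrib]
  have hsmul₂ : ∀ (c : ℂ) g h, F g (c • h) = (RingHom.id ℂ) c • F g h := by
    intro c g h
    simp only [hF, coeff_smul, smul_eq_mul, RingHom.id_apply, Finset.mul_sum]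
    exact Finset.sum_congr rfl fun m _ => by ring
  refine ⟨LinearMap.mk₂'ₛₗ (starRingEnd ℂ) (RingHom.id ℂ) F hadd₁ hsmul₁ hadd₂ hsmul₂, ?_, ?_⟩
  · -- definiteness: `⟪v, v⟫ = Σ |v_m|²`
    intro v hv
    change F v v = 0 at hv
    rw [hF] at hv
    have hterm : ∀ m ∈ v.support, (starRingEnd ℂ) (coeff m v) * coeff m v = ((Complex.normSq (coeff m v) : ℝ) : ℂ) :=
      fun m _ => Complex.normSq_eq_conj_mul_self.symm
    rw [Finset.sum_congr rfl hterm] at hv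
    have hv' : ∑ m ∈ v.support, Complex.normSq (coeff m v) = 0 := by exact_mod_cast hv
    rw [Finset.sum_eq_zero_iff_of_nonneg (fun m _ => Complex.normSq_nonneg _)] at hv'
    ext m
    rw [coeff_zero]
    by_cases hm : m ∈ v.support
    · exact Complex.normSq_eq_zero.1 (hv' m hm)
    · simpa [mem_support_iff] using hm
  · -- invariance under renaming by a permutation
    intro e g h
    change F (rename e g) (rename e h) = F g h
    rw [hF, hF, support_rename_of_injective e.injective, Finset.sum_image
      (fun m _ m' _ hmm' => Finsupp.mapDomain_injective e.injective hmm')]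
    refine Finset.sum_congr rfl fun m _ => ?_
    rw [coeff_rename_mapDomain e e.injective, coeff_rename_mapDomain e e.injective]

/-- Transport: for symmetric `p`, vanishing of the difference-derivative fold does not depend on the pair system.
[folklore] -/
theorem deltaFold_eq_zero_transport {N j : ℕ} (p : MvPolynomial (Fin N) ℂ) (hs : p.IsSymmetric)
    (a b a₁ b₁ : Fin j → Fin N)
    (ha : Function.Injective a) (hb : Function.Injective b) (hab : ∀ i i', a i ≠ b i')
    (ha₁ : Function.Injective a₁) (hb₁ : Function.Injective b₁) (hab₁ : ∀ i i', a₁ i ≠ b₁ i')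
    (h0 : List.foldl (fun (q : MvPolynomial (Fin N) ℂ) i => pderiv (a i) q - pderiv (b i) q) p
      (List.finRange j) = 0) :
    List.foldl (fun (q : MvPolynomial (Fin N) ℂ) i => pderiv (a₁ i) q - pderiv (b₁ i) q) p
      (List.finRange j) = 0 := by
  obtain ⟨g, hga, hgb⟩ := SmlPeeling.exists_perm_conj a b a₁ b₁ ha hb hab ha₁ hb₁ hab₁
  have h := congrArg (rename g) h0
  rw [rename_deltaFoldList g g.injective, map_zero, hs g] at h
  simp only [hga, hgb] at h
  exact h

/-- **Low flattening rank forces narrowness.**  If `p ∈ ℂ[y_1..y_N]` is symmetric, homogeneous of degree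
`d ≤ N`, `2j ≤ N`, and all its `j`-th order iterated partial derivatives lie in the span of a finite set of fewer
than `C(N-j, j)` polynomials, then `p` is a combination of power-sum products with fewer than `j` parts `≥ 2`.
[folklore] -/
theorem narrow_of_derivs_in_small_span {N d j : ℕ} (hdN : d ≤ N) (h2j : 2 * j ≤ N)
    (p : MvPolynomial (Fin N) ℂ) (hs : p.IsSymmetric) (hh : p.IsHomogeneous d)
    (w : Finset (MvPolynomial (Fin N) ℂ))
    (hw : ∀ ρ : Fin j → Fin N,
      List.foldl (fun (q : MvPolynomial (Fin N) ℂ) i => pderiv (ρ i) q) p (List.finRange j) ∈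
        Submodule.span ℂ (w : Set (MvPolynomial (Fin N) ℂ)))
    (hcard : w.card < Nat.choose (N - j) j) :
    ∃ (S : Finset (Multiset ℕ)) (c : Multiset ℕ → ℂ),
      (∀ μ ∈ S, (∀ k ∈ μ, 0 < k) ∧ μ.sum = d ∧ (μ.filter fun k => 2 ≤ k).card < j) ∧
      p = ∑ μ ∈ S, c μ • (μ.map (psum (Fin N) ℂ)).prod := by
  classical
  -- the canonical pair system: `b i = i` (first `j` variables) and the `j`-subsets of the rest
  obtain ⟨b, hbdef⟩ : ∃ b : Fin j → Fin N, ∀ i, b i = ⟨(i : ℕ), by omega⟩ := ⟨_, fun _ => rfl⟩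
  have hb : Function.Injective b := by
    intro i i' h; rw [hbdef, hbdef, Fin.mk.injEq] at h; exact Fin.ext h
  have hTcard : ∀ x : ↥((Finset.univ \ Finset.univ.image b).powersetCard j), (x : Finset (Fin N)).card = j :=
    fun x => (Finset.mem_powersetCard.1 x.2).2
  have hTsub : ∀ x : ↥((Finset.univ \ Finset.univ.image b).powersetCard j),
      (x : Finset (Fin N)) ⊆ Finset.univ \ Finset.univ.image b := fun x => (Finset.mem_powersetCard.1 x.2).1
  obtain ⟨a, hadef⟩ : ∃ a : ↥((Finset.univ \ Finset.univ.image b).powersetCard j) → Fin j → Fin N,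
      ∀ x, a x = (x : Finset (Fin N)).orderEmbOfFin (hTcard x) := ⟨_, fun _ => rfl⟩
  have ha : ∀ x, Function.Injective (a x) := fun x => by
    rw [hadef]; exact ((x : Finset (Fin N)).orderEmbOfFin (hTcard x)).injective
  have hrange : ∀ x, Set.range (a x) = ((x : Finset (Fin N)) : Set (Fin N)) := fun x => by
    rw [hadef]; exact Finset.range_orderEmbOfFin _ _
  have hamem : ∀ (x : ↥((Finset.univ \ Finset.univ.image b).powersetCard j)) (i : Fin j),
      a x i ∈ (x : Finset (Fin N)) := fun x i => by
    rw [← Finset.mem_coe, ← hrange x]; exact ⟨i, rfl⟩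
  have hab : ∀ x i i', a x i ≠ b i' := by
    intro x i i' h
    have hmem := hTsub x (hamem x i)
    rw [h, Finset.mem_sdiff] at hmem
    exact hmem.2 (Finset.mem_image_of_mem b (Finset.mem_univ i'))
  have hsep : ∀ x y : ↥((Finset.univ \ Finset.univ.image b).powersetCard j), x ≠ y →
      ∃ i, a y i ∉ Set.range (a x) := by
    intro x y hxy
    by_contra hcon
    simp only [not_exists, not_not] at hcon
    apply hxy
    have hsub : (y : Finset (Fin N)) ⊆ (x : Finset (Fin N)) := by
      intro v hv
      have hv' : v ∈ Set.range (a y) := by rw [hrange y]; exact hv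
      obtain ⟨i, rfl⟩ := hv'
      have := hcon i
      rw [hrange x] at this
      exact this
    exact Subtype.ext (Finset.eq_of_subset_of_card_le hsub (by rw [hTcard x, hTcard y])).symm
  -- dichotomy on the canonical difference derivatives
  by_cases hzero : ∃ x : ↥((Finset.univ \ Finset.univ.image b).powersetCard j),
      List.foldl (fun (q : MvPolynomial (Fin N) ℂ) i => pderiv (a x i) q - pderiv (b i) q) p
        (List.finRange j) = 0
  · obtain ⟨x, hx⟩ := hzero
    exact narrow_of_deltaFold_eq_zero hdN (a x) b (ha x) hb (hab x) p hs hh hx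
  · -- otherwise every alternating pair sum is nonzero and the Johnson rank lemma contradicts `hcard`
    exfalso
    simp only [not_exists] at hzero
    obtain ⟨B, hBdef, hBinv⟩ := exists_coeffPairing (Fin N)
    have hinv : ∀ (g : Equiv.Perm (Fin N)) (ρ ρ' : Fin j → Fin N),
        B (List.foldl (fun (q : MvPolynomial (Fin N) ℂ) i => pderiv ((g ∘ ρ) i) q) p (List.finRange j))
          (List.foldl (fun (q : MvPolynomial (Fin N) ℂ) i => pderiv ((g ∘ ρ') i) q) p (List.finRange j)) =
        B (List.foldl (fun (q : MvPolynomial (Fin N) ℂ) i => pderiv (ρ i) q) p (List.finRange j))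
          (List.foldl (fun (q : MvPolynomial (Fin N) ℂ) i => pderiv (ρ' i) q) p (List.finRange j)) := by
      intro g ρ ρ'
      have h1 := rename_pderivFoldList g g.injective ρ (List.finRange j) p
      have h2 := rename_pderivFoldList g g.injective ρ' (List.finRange j) p
      rw [hs g] at h1 h2
      simp only [Function.comp_apply]
      rw [← h1, ← h2, hBinv]
    have he : ∀ x : ↥((Finset.univ \ Finset.univ.image b).powersetCard j),
        (∑ ε : Fin j → Bool, ((-1 : ℂ) ^ (univ.filter fun i => ε i = true).card) •
          List.foldl (fun (q : MvPolynomial (Fin N) ℂ) i => pderiv (if ε i then b i else a x i) q) p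
            (List.finRange j)) ≠ 0 := by
      intro x hx
      apply hzero x
      rw [deltaFold_eq_sum_bool, ← hx]
      refine Finset.sum_congr rfl fun ε _ => ?_
      rw [← Int.cast_smul_eq_zsmul ℂ]
      push_cast
      rfl
    have hle := johnson_card_le B hBdef
      (fun ρ : Fin j → Fin N =>
        List.foldl (fun (q : MvPolynomial (Fin N) ℂ) i => pderiv (ρ i) q) p (List.finRange j))
      hinv a b ha hb hab hsep he w hw
    -- `card = C(N - j, j)`
    have hcardT : Fintype.card ↥((Finset.univ \ Finset.univ.image b).powersetCard j) = Nat.choose (N - j) j := by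
      rw [Fintype.card_coe, Finset.card_powersetCard, Finset.card_sdiff_of_subset (Finset.subset_univ _),
        Finset.card_univ, Fintype.card_fin, Finset.card_image_of_injective _ hb, Finset.card_univ,
        Fintype.card_fin]
    rw [hcardT] at hle
    omega

end Summit.ValiantsHypothesis.ValiantsHypothesis.Theorems.SmlLowRankNarrow
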